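import Mathlib
import Literature.NumberTheory.Irrationality.BrownZudilin2022.GeneralFamily
import Literature.NumberTheory.Irrationality.BrownZudilin2022.CubicalForm
import Literature.NumberTheory.Irrationality.BrownZudilin2022.BarnesRepresentation
import Summits.KontsevichZagierPeriods.Zeta5Search.WedgeDictionaryThreeTerm
import Summits.KontsevichZagierPeriods.Zeta5Search.WedgeDictionaryKernelTransport

/-!
# (H1)-free cellular relations by TRANSPORT, part B1: factorial shift lemmas for `slotDown 1`, `slotDown 2`, `slotDown 3`, `slotDown 4` (cell `pub-zeta5`, lineage gen-1, g21)

HONEST FRAMING: systematic search; no irrationality claim unless certified.  Structure of gen-1's period dictionary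
(`WedgeDictionary.explicitPQ`, an OPEN conjecture node) only; nothing about linear forms or ζ(5); nothing is evaluated.

OUR work (Summit side); no hypotheses beyond convergence.  For each of the eight difference vectors `v` of the cells (`slotDown k`,
`k = 1..7`, and `dsUp`): the F-forms `h_i`, `i ∈ F`, change under `a ↦ a + v` by `c_i ∈ {−1,0,1}`; with `shiftD_v a = ∏_{c_i=−1} h_i(a)` and
`shiftU_v a = ∏_{c_i=+1} (h_i(a)+1)` (integers), `prodF (a + v) · shiftD_v a = prodF a · shiftU_v a` whenever `a` and `a + v` converge
(`prodF_<v>`), and both shift factors are then positive (`shiftD_<v>_pos`, `shiftU_<v>_pos`).  Pure factorial bookkeeping.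
-/

set_option maxHeartbeats 8000000
set_option linter.unusedSimpArgs false
set_option linter.unusedTactic false
set_option linter.unreachableTactic false
set_option linter.unnecessarySeqFocus false
set_option linter.style.longLine false
set_option linter.unusedVariables false

namespace Summit.KontsevichZagierPeriods.Zeta5Search.WedgeDictionary.KernelCells

open Literature.NumberTheory.Irrationality.BrownZudilin2022 MeasureTheory

/-- `∏ h_i(a)` over the F-forms that DROP by one under `a ↦ a + slotDown 1` (forms none). -/
def shiftD1 (a : Fin 8 → ℤ) : ℤ := 1
/-- `∏ (h_i(a)+1)` over the F-forms that RISE by one under `a ↦ a + slotDown 1` (forms [1, 10, 11, 9]). -/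
def shiftU1 (a : Fin 8 → ℤ) : ℤ := (hForm a 1 + 1) * (hForm a 10 + 1) * (hForm a 11 + 1) * (hForm a 9 + 1)

/-- Factorial shift under `a ↦ a + slotDown 1`: `prodF (a + v)·shiftD = prodF a·shiftU` for `a`, `a + v` convergent. -/
theorem prodF_slotDown1 (a : Fin 8 → ℤ) (h0 : Converges a) (h1 : Converges (a + slotDown 1)) :
    prodF (a + slotDown 1) * (shiftD1 a : ℝ) = prodF a * (shiftU1 a : ℝ) := by
  have e1 : hForm (a + slotDown 1) 1 = hForm a 1 + 1 := by simp [hForm, hList, slotDown, dsUp]; try ring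
  have e2 : hForm (a + slotDown 1) 2 = hForm a 2 := by simp [hForm, hList, slotDown, dsUp]; try ring
  have e3 : hForm (a + slotDown 1) 3 = hForm a 3 := by simp [hForm, hList, slotDown, dsUp]; try ring
  have e4 : hForm (a + slotDown 1) 4 = hForm a 4 := by simp [hForm, hList, slotDown, dsUp]; try ring
  have e5 : hForm (a + slotDown 1) 5 = hForm a 5 := by simp [hForm, hList, slotDown, dsUp]; try ring
  have e6 : hForm (a + slotDown 1) 6 = hForm a 6 := by simp [hForm, hList, slotDown, dsUp]; try ring
  have e7 : hForm (a + slotDown 1) 7 = hForm a 7 := by simp [hForm, hList, slotDown, dsUp]; try ring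
  have e10 : hForm (a + slotDown 1) 10 = hForm a 10 + 1 := by simp [hForm, hList, slotDown, dsUp]; try ring
  have e14 : hForm (a + slotDown 1) 14 = hForm a 14 := by simp [hForm, hList, slotDown, dsUp]; try ring
  have e28 : hForm (a + slotDown 1) 28 = hForm a 28 := by simp [hForm, hList, slotDown, dsUp]; try ring
  have e20 : hForm (a + slotDown 1) 20 = hForm a 20 := by simp [hForm, hList, slotDown, dsUp]; try ring
  have e18 : hForm (a + slotDown 1) 18 = hForm a 18 := by simp [hForm, hList, slotDown, dsUp]; try ring
  have e23 : hForm (a + slotDown 1) 23 = hForm a 23 := by simp [hForm, hList, slotDown, dsUp]; try ring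
  have e11 : hForm (a + slotDown 1) 11 = hForm a 11 + 1 := by simp [hForm, hList, slotDown, dsUp]; try ring
  have e9 : hForm (a + slotDown 1) 9 = hForm a 9 + 1 := by simp [hForm, hList, slotDown, dsUp]; try ring
  have e16 : hForm (a + slotDown 1) 16 = hForm a 16 := by simp [hForm, hList, slotDown, dsUp]; try ring
  have e27 : hForm (a + slotDown 1) 27 = hForm a 27 := by simp [hForm, hList, slotDown, dsUp]; try ring
  have g1 : 0 ≤ hForm a 1 := hForm_nonneg h0 1 (by decide)
  have g10 : 0 ≤ hForm a 10 := hForm_nonneg h0 10 (by decide)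
  have g11 : 0 ≤ hForm a 11 := hForm_nonneg h0 11 (by decide)
  have g9 : 0 ≤ hForm a 9 := hForm_nonneg h0 9 (by decide)
  rw [prodF_unfold, prodF_unfold, e1, e2, e3, e4, e5, e6, e7, e10, e14, e28, e20, e18, e23, e11, e9, e16, e27]
  rw [fact_split (hForm a 1 + 1) (by omega), fact_split (hForm a 10 + 1) (by omega), fact_split (hForm a 11 + 1) (by omega), fact_split (hForm a 9 + 1) (by omega)]
  simp only [add_sub_cancel_right]
  simp only [shiftD1, shiftU1]; push_cast; ring

/-- Positivity of `shiftD` under convergence of `a + slotDown 1`. -/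
theorem shiftD1_pos (a : Fin 8 → ℤ) (h1 : Converges (a + slotDown 1)) : (0 : ℝ) < (shiftD1 a : ℝ) := by
  simp only [shiftD1]; push_cast; positivity

/-- Positivity of `shiftU` under convergence of `a`. -/
theorem shiftU1_pos (a : Fin 8 → ℤ) (h0 : Converges a) : (0 : ℝ) < (shiftU1 a : ℝ) := by
  have g1 : (0 : ℝ) ≤ (hForm a 1 : ℝ) := by exact_mod_cast hForm_nonneg h0 1 (by decide)
  have g10 : (0 : ℝ) ≤ (hForm a 10 : ℝ) := by exact_mod_cast hForm_nonneg h0 10 (by decide)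
  have g11 : (0 : ℝ) ≤ (hForm a 11 : ℝ) := by exact_mod_cast hForm_nonneg h0 11 (by decide)
  have g9 : (0 : ℝ) ≤ (hForm a 9 : ℝ) := by exact_mod_cast hForm_nonneg h0 9 (by decide)
  simp only [shiftU1]; push_cast; positivity

/-- `∏ h_i(a)` over the F-forms that DROP by one under `a ↦ a + slotDown 2` (forms [2]). -/
def shiftD2 (a : Fin 8 → ℤ) : ℤ := hForm a 2
/-- `∏ (h_i(a)+1)` over the F-forms that RISE by one under `a ↦ a + slotDown 2` (forms [1, 3, 14, 18, 16]). -/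
def shiftU2 (a : Fin 8 → ℤ) : ℤ := (hForm a 1 + 1) * (hForm a 3 + 1) * (hForm a 14 + 1) * (hForm a 18 + 1) * (hForm a 16 + 1)

/-- Factorial shift under `a ↦ a + slotDown 2`: `prodF (a + v)·shiftD = prodF a·shiftU` for `a`, `a + v` convergent. -/
theorem prodF_slotDown2 (a : Fin 8 → ℤ) (h0 : Converges a) (h1 : Converges (a + slotDown 2)) :
    prodF (a + slotDown 2) * (shiftD2 a : ℝ) = prodF a * (shiftU2 a : ℝ) := by
  have e1 : hForm (a + slotDown 2) 1 = hForm a 1 + 1 := by simp [hForm, hList, slotDown, dsUp]; try ring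
  have e2 : hForm (a + slotDown 2) 2 = hForm a 2 - 1 := by simp [hForm, hList, slotDown, dsUp]; try ring
  have e3 : hForm (a + slotDown 2) 3 = hForm a 3 + 1 := by simp [hForm, hList, slotDown, dsUp]; try ring
  have e4 : hForm (a + slotDown 2) 4 = hForm a 4 := by simp [hForm, hList, slotDown, dsUp]; try ring
  have e5 : hForm (a + slotDown 2) 5 = hForm a 5 := by simp [hForm, hList, slotDown, dsUp]; try ring
  have e6 : hForm (a + slotDown 2) 6 = hForm a 6 := by simp [hForm, hList, slotDown, dsUp]; try ring
  have e7 : hForm (a + slotDown 2) 7 = hForm a 7 := by simp [hForm, hList, slotDown, dsUp]; try ring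
  have e10 : hForm (a + slotDown 2) 10 = hForm a 10 := by simp [hForm, hList, slotDown, dsUp]; try ring
  have e14 : hForm (a + slotDown 2) 14 = hForm a 14 + 1 := by simp [hForm, hList, slotDown, dsUp]; try ring
  have e28 : hForm (a + slotDown 2) 28 = hForm a 28 := by simp [hForm, hList, slotDown, dsUp]; try ring
  have e20 : hForm (a + slotDown 2) 20 = hForm a 20 := by simp [hForm, hList, slotDown, dsUp]; try ring
  have e18 : hForm (a + slotDown 2) 18 = hForm a 18 + 1 := by simp [hForm, hList, slotDown, dsUp]; try ring
  have e23 : hForm (a + slotDown 2) 23 = hForm a 23 := by simp [hForm, hList, slotDown, dsUp]; try ring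
  have e11 : hForm (a + slotDown 2) 11 = hForm a 11 := by simp [hForm, hList, slotDown, dsUp]; try ring
  have e9 : hForm (a + slotDown 2) 9 = hForm a 9 := by simp [hForm, hList, slotDown, dsUp]; try ring
  have e16 : hForm (a + slotDown 2) 16 = hForm a 16 + 1 := by simp [hForm, hList, slotDown, dsUp]; try ring
  have e27 : hForm (a + slotDown 2) 27 = hForm a 27 := by simp [hForm, hList, slotDown, dsUp]; try ring
  have g2 : 1 ≤ hForm a 2 := by have := hForm_nonneg h1 2 (by decide); rw [e2] at this; omega
  have g1 : 0 ≤ hForm a 1 := hForm_nonneg h0 1 (by decide)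
  have g3 : 0 ≤ hForm a 3 := hForm_nonneg h0 3 (by decide)
  have g14 : 0 ≤ hForm a 14 := hForm_nonneg h0 14 (by decide)
  have g18 : 0 ≤ hForm a 18 := hForm_nonneg h0 18 (by decide)
  have g16 : 0 ≤ hForm a 16 := hForm_nonneg h0 16 (by decide)
  rw [prodF_unfold, prodF_unfold, e1, e2, e3, e4, e5, e6, e7, e10, e14, e28, e20, e18, e23, e11, e9, e16, e27]
  rw [fact_split (hForm a 1 + 1) (by omega), fact_split (hForm a 3 + 1) (by omega), fact_split (hForm a 14 + 1) (by omega), fact_split (hForm a 18 + 1) (by omega), fact_split (hForm a 16 + 1) (by omega), fact_split (hForm a 2) g2]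
  simp only [add_sub_cancel_right]
  simp only [shiftD2, shiftU2]; push_cast; ring

/-- Positivity of `shiftD` under convergence of `a + slotDown 2`. -/
theorem shiftD2_pos (a : Fin 8 → ℤ) (h1 : Converges (a + slotDown 2)) : (0 : ℝ) < (shiftD2 a : ℝ) := by
  have e2 : hForm (a + slotDown 2) 2 = hForm a 2 - 1 := by simp [hForm, hList, slotDown, dsUp]; try ring
  have g2 : (1 : ℝ) ≤ (hForm a 2 : ℝ) := by
    have := hForm_nonneg h1 2 (by decide)
    rw [e2] at this
    exact_mod_cast (by omega : (1:ℤ) ≤ hForm a 2)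
  simp only [shiftD2]; push_cast; linarith

/-- Positivity of `shiftU` under convergence of `a`. -/
theorem shiftU2_pos (a : Fin 8 → ℤ) (h0 : Converges a) : (0 : ℝ) < (shiftU2 a : ℝ) := by
  have g1 : (0 : ℝ) ≤ (hForm a 1 : ℝ) := by exact_mod_cast hForm_nonneg h0 1 (by decide)
  have g3 : (0 : ℝ) ≤ (hForm a 3 : ℝ) := by exact_mod_cast hForm_nonneg h0 3 (by decide)
  have g14 : (0 : ℝ) ≤ (hForm a 14 : ℝ) := by exact_mod_cast hForm_nonneg h0 14 (by decide)
  have g18 : (0 : ℝ) ≤ (hForm a 18 : ℝ) := by exact_mod_cast hForm_nonneg h0 18 (by decide)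
  have g16 : (0 : ℝ) ≤ (hForm a 16 : ℝ) := by exact_mod_cast hForm_nonneg h0 16 (by decide)
  simp only [shiftU2]; push_cast; positivity

/-- `∏ h_i(a)` over the F-forms that DROP by one under `a ↦ a + slotDown 3` (forms [4]). -/
def shiftD3 (a : Fin 8 → ℤ) : ℤ := hForm a 4
/-- `∏ (h_i(a)+1)` over the F-forms that RISE by one under `a ↦ a + slotDown 3` (forms [3, 5, 20, 23, 9]). -/
def shiftU3 (a : Fin 8 → ℤ) : ℤ := (hForm a 3 + 1) * (hForm a 5 + 1) * (hForm a 20 + 1) * (hForm a 23 + 1) * (hForm a 9 + 1)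

/-- Factorial shift under `a ↦ a + slotDown 3`: `prodF (a + v)·shiftD = prodF a·shiftU` for `a`, `a + v` convergent. -/
theorem prodF_slotDown3 (a : Fin 8 → ℤ) (h0 : Converges a) (h1 : Converges (a + slotDown 3)) :
    prodF (a + slotDown 3) * (shiftD3 a : ℝ) = prodF a * (shiftU3 a : ℝ) := by
  have e1 : hForm (a + slotDown 3) 1 = hForm a 1 := by simp [hForm, hList, slotDown, dsUp]; try ring
  have e2 : hForm (a + slotDown 3) 2 = hForm a 2 := by simp [hForm, hList, slotDown, dsUp]; try ring
  have e3 : hForm (a + slotDown 3) 3 = hForm a 3 + 1 := by simp [hForm, hList, slotDown, dsUp]; try ring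
  have e4 : hForm (a + slotDown 3) 4 = hForm a 4 - 1 := by simp [hForm, hList, slotDown, dsUp]; try ring
  have e5 : hForm (a + slotDown 3) 5 = hForm a 5 + 1 := by simp [hForm, hList, slotDown, dsUp]; try ring
  have e6 : hForm (a + slotDown 3) 6 = hForm a 6 := by simp [hForm, hList, slotDown, dsUp]; try ring
  have e7 : hForm (a + slotDown 3) 7 = hForm a 7 := by simp [hForm, hList, slotDown, dsUp]; try ring
  have e10 : hForm (a + slotDown 3) 10 = hForm a 10 := by simp [hForm, hList, slotDown, dsUp]; try ring
  have e14 : hForm (a + slotDown 3) 14 = hForm a 14 := by simp [hForm, hList, slotDown, dsUp]; try ring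
  have e28 : hForm (a + slotDown 3) 28 = hForm a 28 := by simp [hForm, hList, slotDown, dsUp]; try ring
  have e20 : hForm (a + slotDown 3) 20 = hForm a 20 + 1 := by simp [hForm, hList, slotDown, dsUp]; try ring
  have e18 : hForm (a + slotDown 3) 18 = hForm a 18 := by simp [hForm, hList, slotDown, dsUp]; try ring
  have e23 : hForm (a + slotDown 3) 23 = hForm a 23 + 1 := by simp [hForm, hList, slotDown, dsUp]; try ring
  have e11 : hForm (a + slotDown 3) 11 = hForm a 11 := by simp [hForm, hList, slotDown, dsUp]; try ring
  have e9 : hForm (a + slotDown 3) 9 = hForm a 9 + 1 := by simp [hForm, hList, slotDown, dsUp]; try ring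
  have e16 : hForm (a + slotDown 3) 16 = hForm a 16 := by simp [hForm, hList, slotDown, dsUp]; try ring
  have e27 : hForm (a + slotDown 3) 27 = hForm a 27 := by simp [hForm, hList, slotDown, dsUp]; try ring
  have g4 : 1 ≤ hForm a 4 := by have := hForm_nonneg h1 4 (by decide); rw [e4] at this; omega
  have g3 : 0 ≤ hForm a 3 := hForm_nonneg h0 3 (by decide)
  have g5 : 0 ≤ hForm a 5 := hForm_nonneg h0 5 (by decide)
  have g20 : 0 ≤ hForm a 20 := hForm_nonneg h0 20 (by decide)
  have g23 : 0 ≤ hForm a 23 := hForm_nonneg h0 23 (by decide)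
  have g9 : 0 ≤ hForm a 9 := hForm_nonneg h0 9 (by decide)
  rw [prodF_unfold, prodF_unfold, e1, e2, e3, e4, e5, e6, e7, e10, e14, e28, e20, e18, e23, e11, e9, e16, e27]
  rw [fact_split (hForm a 3 + 1) (by omega), fact_split (hForm a 5 + 1) (by omega), fact_split (hForm a 20 + 1) (by omega), fact_split (hForm a 23 + 1) (by omega), fact_split (hForm a 9 + 1) (by omega), fact_split (hForm a 4) g4]
  simp only [add_sub_cancel_right]
  simp only [shiftD3, shiftU3]; push_cast; ring

/-- Positivity of `shiftD` under convergence of `a + slotDown 3`. -/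
theorem shiftD3_pos (a : Fin 8 → ℤ) (h1 : Converges (a + slotDown 3)) : (0 : ℝ) < (shiftD3 a : ℝ) := by
  have e4 : hForm (a + slotDown 3) 4 = hForm a 4 - 1 := by simp [hForm, hList, slotDown, dsUp]; try ring
  have g4 : (1 : ℝ) ≤ (hForm a 4 : ℝ) := by
    have := hForm_nonneg h1 4 (by decide)
    rw [e4] at this
    exact_mod_cast (by omega : (1:ℤ) ≤ hForm a 4)
  simp only [shiftD3]; push_cast; linarith

/-- Positivity of `shiftU` under convergence of `a`. -/
theorem shiftU3_pos (a : Fin 8 → ℤ) (h0 : Converges a) : (0 : ℝ) < (shiftU3 a : ℝ) := by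
  have g3 : (0 : ℝ) ≤ (hForm a 3 : ℝ) := by exact_mod_cast hForm_nonneg h0 3 (by decide)
  have g5 : (0 : ℝ) ≤ (hForm a 5 : ℝ) := by exact_mod_cast hForm_nonneg h0 5 (by decide)
  have g20 : (0 : ℝ) ≤ (hForm a 20 : ℝ) := by exact_mod_cast hForm_nonneg h0 20 (by decide)
  have g23 : (0 : ℝ) ≤ (hForm a 23 : ℝ) := by exact_mod_cast hForm_nonneg h0 23 (by decide)
  have g9 : (0 : ℝ) ≤ (hForm a 9 : ℝ) := by exact_mod_cast hForm_nonneg h0 9 (by decide)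
  simp only [shiftU3]; push_cast; positivity

/-- `∏ h_i(a)` over the F-forms that DROP by one under `a ↦ a + slotDown 4` (forms none). -/
def shiftD4 (a : Fin 8 → ℤ) : ℤ := 1
/-- `∏ (h_i(a)+1)` over the F-forms that RISE by one under `a ↦ a + slotDown 4` (forms [5, 10, 28, 16]). -/
def shiftU4 (a : Fin 8 → ℤ) : ℤ := (hForm a 5 + 1) * (hForm a 10 + 1) * (hForm a 28 + 1) * (hForm a 16 + 1)

/-- Factorial shift under `a ↦ a + slotDown 4`: `prodF (a + v)·shiftD = prodF a·shiftU` for `a`, `a + v` convergent. -/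
theorem prodF_slotDown4 (a : Fin 8 → ℤ) (h0 : Converges a) (h1 : Converges (a + slotDown 4)) :
    prodF (a + slotDown 4) * (shiftD4 a : ℝ) = prodF a * (shiftU4 a : ℝ) := by
  have e1 : hForm (a + slotDown 4) 1 = hForm a 1 := by simp [hForm, hList, slotDown, dsUp]; try ring
  have e2 : hForm (a + slotDown 4) 2 = hForm a 2 := by simp [hForm, hList, slotDown, dsUp]; try ring
  have e3 : hForm (a + slotDown 4) 3 = hForm a 3 := by simp [hForm, hList, slotDown, dsUp]; try ring
  have e4 : hForm (a + slotDown 4) 4 = hForm a 4 := by simp [hForm, hList, slotDown, dsUp]; try ring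
  have e5 : hForm (a + slotDown 4) 5 = hForm a 5 + 1 := by simp [hForm, hList, slotDown, dsUp]; try ring
  have e6 : hForm (a + slotDown 4) 6 = hForm a 6 := by simp [hForm, hList, slotDown, dsUp]; try ring
  have e7 : hForm (a + slotDown 4) 7 = hForm a 7 := by simp [hForm, hList, slotDown, dsUp]; try ring
  have e10 : hForm (a + slotDown 4) 10 = hForm a 10 + 1 := by simp [hForm, hList, slotDown, dsUp]; try ring
  have e14 : hForm (a + slotDown 4) 14 = hForm a 14 := by simp [hForm, hList, slotDown, dsUp]; try ring
  have e28 : hForm (a + slotDown 4) 28 = hForm a 28 + 1 := by simp [hForm, hList, slotDown, dsUp]; try ring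
  have e20 : hForm (a + slotDown 4) 20 = hForm a 20 := by simp [hForm, hList, slotDown, dsUp]; try ring
  have e18 : hForm (a + slotDown 4) 18 = hForm a 18 := by simp [hForm, hList, slotDown, dsUp]; try ring
  have e23 : hForm (a + slotDown 4) 23 = hForm a 23 := by simp [hForm, hList, slotDown, dsUp]; try ring
  have e11 : hForm (a + slotDown 4) 11 = hForm a 11 := by simp [hForm, hList, slotDown, dsUp]; try ring
  have e9 : hForm (a + slotDown 4) 9 = hForm a 9 := by simp [hForm, hList, slotDown, dsUp]; try ring
  have e16 : hForm (a + slotDown 4) 16 = hForm a 16 + 1 := by simp [hForm, hList, slotDown, dsUp]; try ring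
  have e27 : hForm (a + slotDown 4) 27 = hForm a 27 := by simp [hForm, hList, slotDown, dsUp]; try ring
  have g5 : 0 ≤ hForm a 5 := hForm_nonneg h0 5 (by decide)
  have g10 : 0 ≤ hForm a 10 := hForm_nonneg h0 10 (by decide)
  have g28 : 0 ≤ hForm a 28 := hForm_nonneg h0 28 (by decide)
  have g16 : 0 ≤ hForm a 16 := hForm_nonneg h0 16 (by decide)
  rw [prodF_unfold, prodF_unfold, e1, e2, e3, e4, e5, e6, e7, e10, e14, e28, e20, e18, e23, e11, e9, e16, e27]
  rw [fact_split (hForm a 5 + 1) (by omega), fact_split (hForm a 10 + 1) (by omega), fact_split (hForm a 28 + 1) (by omega), fact_split (hForm a 16 + 1) (by omega)]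
  simp only [add_sub_cancel_right]
  simp only [shiftD4, shiftU4]; push_cast; ring

/-- Positivity of `shiftD` under convergence of `a + slotDown 4`. -/
theorem shiftD4_pos (a : Fin 8 → ℤ) (h1 : Converges (a + slotDown 4)) : (0 : ℝ) < (shiftD4 a : ℝ) := by
  simp only [shiftD4]; push_cast; positivity

/-- Positivity of `shiftU` under convergence of `a`. -/
theorem shiftU4_pos (a : Fin 8 → ℤ) (h0 : Converges a) : (0 : ℝ) < (shiftU4 a : ℝ) := by
  have g5 : (0 : ℝ) ≤ (hForm a 5 : ℝ) := by exact_mod_cast hForm_nonneg h0 5 (by decide)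
  have g10 : (0 : ℝ) ≤ (hForm a 10 : ℝ) := by exact_mod_cast hForm_nonneg h0 10 (by decide)
  have g28 : (0 : ℝ) ≤ (hForm a 28 : ℝ) := by exact_mod_cast hForm_nonneg h0 28 (by decide)
  have g16 : (0 : ℝ) ≤ (hForm a 16 : ℝ) := by exact_mod_cast hForm_nonneg h0 16 (by decide)
  simp only [shiftU4]; push_cast; positivity

end Summit.KontsevichZagierPeriods.Zeta5Search.WedgeDictionary.KernelCells
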